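import Summits.AtomisticToContinuum.Crystallization.Theorems.ChargedEnergyGapKinkBudgetC
import HarnessLib

/-!
# ChargedEnergyGap · NODE 84 «KinkBudget» (lens-3 g83) — file D: (F₃) ⟸ (Σ₃) PROVED — THE RESIDUAL IS A FINITE-DIMENSIONAL REAL SYSTEM

Line of record `stmt-AtomisticToContinuum-14231` (`Summit.AtomisticToContinuum.ChargedEnergyGap`), route PricedLinkCensus.  Files A–C left ONE leaf
beneath (F_lo): (F₃) `FibreChargeThreeMidQ` — a statement about depth SEQUENCES `e : ℤ → ℝ` with three marked holes (a one-dimensional control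
problem).  THIS FILE trades it for a CLOSED FIRST-ORDER STATEMENT OF REAL ARITHMETIC over two even naturals `n₁, n₂ ≤ 240` and `15` reals — (Σ₃)
`ThreeHoleSystemQ ρlo ρhi` — and PROVES (F₃) ⟸ (Σ₃) (`fibreChargeThreeMidQ_of_system`).

THE TRANSLATION.  A marked fibre with holes `t₁ < t₂ < t₃` is read off at the holes only: per hole the data `(e, m, a, b, k)` = depth, min-depth,
outgoing drop `a = e(t) − e(t+1)`, incoming rise `b = e(t) − e(t−1)`, kink `k` with `a + b = kρ`, subject to `IsHoleData` (`0 ≤ a, b ≤ ρ`; the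
min-depth window `e − ρ ≤ m ≤ e − max(a, b)`; the table conditions row `≥ 1`, column `≥ 2`, `m < 140`); the gaps `n₁ = t₂ − t₁`, `n₂ = t₃ − t₂` (even,
`≥ 1`, window `ρ(n₁ + n₂) ≤ 160 + 2ρ`); and between consecutive holes EXACTLY the four consequences of discrete semiconcavity proved in file A — the
LEG inequality `a_i(2e_i − a_i) + b_{i+1}(2e_{i+1} − b_{i+1}) ≤ 2ρ²(n_i − 1)` (the pair budget unweighted) and the forward / backward PARABOLAS
`e_{i+1}² ≤ e_i² − n_i a_i(2e_i − a_i) + ρ² n_i(n_i − 1)`, `e_i² ≤ e_{i+1}² − n_i b_{i+1}(2e_{i+1} − b_{i+1}) + ρ² n_i(n_i − 1)`.  The conclusion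
`ThreeHoleGoal` lists the three key positions: if hole `p` has the largest kink and column `3 … 6`, the other two charges sum to `≤ E(col k_p, 3)`.
In the continuum limit these necessary conditions are also sufficient for a connecting free-flight profile (`q = e ė` has slope `≤ 1` between holes
and jumps `+e k` at a hole; the extreme profiles are the two parabolas), so (Σ₃) is the honest finite-dimensional content of (F₃); it is DECIDABLE
(finitely many `(n₁, n₂)`, then Tarski arithmetic over piecewise-polynomial constraints with rational table breakpoints) and certifiable by
exact-rational branch-and-bound (census-1 «FLO-84»; `num/syscheck3.py`: none of the `60` highest-charge cell pairs per key column / key position is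
feasible on a sample grid — heuristic evidence only).

Imports ONLY `…ChargedEnergyGapKinkBudgetC` and `HarnessLib`; no `set_option`, no `sorry`, no instance, no notation, no `private`; namespace
`…Theorems.ChargedEnergyGapChartDial`; new names `IsHoleData`, `ThreeHoleGoal`, `ThreeHoleSystemQ`, `kb_holeData`, `kb_three_goal`,
`fibreChargeThreeMidQ_of_system`.
-/

noncomputable section

open scoped Classical
open Literature.MathematicalPhysics.StatisticalMechanics Literature.Geometry.DiscreteGeometry
open Summit.AtomisticToContinuum.Crystallization.Theses.PricedLinkCensus
open Summit.AtomisticToContinuum.Crystallization.Theorems.ChargedEnergyGapNegative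

namespace Summit.AtomisticToContinuum.Crystallization.Theorems.ChargedEnergyGapChartDial

/-! ## §D1 The finite-dimensional three-hole system (Σ₃) -/

section System

/-- ★ HOLE DATA at spacing `ρ`: depth `e`, min-depth `m`, outgoing drop `a`, incoming rise `b`, kink `k` of ONE marked hole — Lipschitz one-sided
steps `0 ≤ a, b ≤ ρ` (a marked hole is a weak local maximum of depth), the kink identity `a + b = kρ`, the min-depth window `e − ρ ≤ m ≤ e − a`,
`m ≤ e − b` (the two neighbours are at depth `≥ m`), and the charged-table conditions (row `≥ 1`, kink column `≥ 2`, `m < 140`). -/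
def IsHoleData (ρ e m a b k : ℝ) : Prop :=
  0 ≤ a ∧ a ≤ ρ ∧ 0 ≤ b ∧ b ≤ ρ ∧ a + b = k * ρ ∧ e - ρ ≤ m ∧ m ≤ e - a ∧ m ≤ e - b ∧
    1 ≤ capKRow m ∧ 2 ≤ capKCol k ∧ m < 140

/-- ★ THE THREE-HOLE GOAL for holes `1 < 2 < 3` with min-depths / kinks `(mᵢ, kᵢ)`: whichever hole carries the (weakly) largest kink and has kink
column `3 … 6`, the other two table charges sum to at most the three-hole line excess of that column. -/
def ThreeHoleGoal (m₁ k₁ m₂ k₂ m₃ k₃ : ℝ) : Prop :=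
  (k₂ ≤ k₁ → k₃ ≤ k₁ → 3 ≤ capKCol k₁ → capKCol k₁ ≤ 6 → capK m₂ k₂ + capK m₃ k₃ ≤ lineExcess (capKCol k₁) 3) ∧
    (k₁ ≤ k₂ → k₃ ≤ k₂ → 3 ≤ capKCol k₂ → capKCol k₂ ≤ 6 → capK m₁ k₁ + capK m₃ k₃ ≤ lineExcess (capKCol k₂) 3) ∧
    (k₁ ≤ k₃ → k₂ ≤ k₃ → 3 ≤ capKCol k₃ → capKCol k₃ ≤ 6 → capK m₁ k₁ + capK m₂ k₂ ≤ lineExcess (capKCol k₃) 3)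

/-- ★★★ **(Σ₃) THE THREE-HOLE SYSTEM** — the residual leaf of NODE 84, a closed statement of real arithmetic: for every spacing `ρ ∈ [ρlo, ρhi]`,
even gaps `n₁, n₂ ≥ 1` inside the window `ρ(n₁ + n₂) ≤ 160 + 2ρ`, and hole data `(eᵢ, mᵢ, aᵢ, bᵢ, kᵢ)`, `i = 1, 2, 3`, obeying the two LEG
inequalities and the four PARABOLA inequalities of consecutive holes, the `ThreeHoleGoal` holds.  [TABLE · FINITE-DIMENSIONAL (`2` even naturals
`≤ 240`, `15` reals; piecewise-polynomial of degree `≤ 3` with rational breakpoints) · DECIDABLE (Tarski) · NEW as typed · TRUE-leaning (it relaxes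
(F₃) only by necessary conditions that are sharp in the continuum; NODE 82's DP certified (F₃) with margin `×1.05 + 0.3`; `num/syscheck3.py` finds
no feasible point among the `60` highest-charge cell pairs per case) · INSTRUMENTABLE (census-1 «FLO-84»: exact-rational interval branch-and-bound
over `(row, column)` cells of the three holes × the continuous remainders, per `(n₁, n₂)` or with `n` relaxed to reals) · FALLBACK: if (Σ₃) fails in
some cell, (F₃) itself remains the leaf (cone `chargedEnergyGap_of_kinkBudget_numerics'`) — why it might fail: the discrete relaxation admits a
configuration the lattice profile cannot realise (an `O(ρ²)` effect at a cell boundary of rows `42–50`) whose charge exceeds `E(j, 3)` by less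
than the DP margin] -/
def ThreeHoleSystemQ (ρlo ρhi : ℝ) : Prop :=
  ∀ ρ : ℝ, ρlo ≤ ρ → ρ ≤ ρhi →
    ∀ (n₁ n₂ : ℕ) (e₁ m₁ a₁ b₁ k₁ e₂ m₂ a₂ b₂ k₂ e₃ m₃ a₃ b₃ k₃ : ℝ),
      Even n₁ → Even n₂ → 1 ≤ n₁ → 1 ≤ n₂ → ρ * ((n₁ : ℝ) + n₂) ≤ 160 + 2 * ρ →
      IsHoleData ρ e₁ m₁ a₁ b₁ k₁ → IsHoleData ρ e₂ m₂ a₂ b₂ k₂ → IsHoleData ρ e₃ m₃ a₃ b₃ k₃ →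
      a₁ * (2 * e₁ - a₁) + b₂ * (2 * e₂ - b₂) ≤ 2 * ρ ^ 2 * ((n₁ : ℝ) - 1) →
      a₂ * (2 * e₂ - a₂) + b₃ * (2 * e₃ - b₃) ≤ 2 * ρ ^ 2 * ((n₂ : ℝ) - 1) →
      e₂ ^ 2 ≤ e₁ ^ 2 - (n₁ : ℝ) * (a₁ * (2 * e₁ - a₁)) + ρ ^ 2 * n₁ * ((n₁ : ℝ) - 1) →
      e₁ ^ 2 ≤ e₂ ^ 2 - (n₁ : ℝ) * (b₂ * (2 * e₂ - b₂)) + ρ ^ 2 * n₁ * ((n₁ : ℝ) - 1) →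
      e₃ ^ 2 ≤ e₂ ^ 2 - (n₂ : ℝ) * (a₂ * (2 * e₂ - a₂)) + ρ ^ 2 * n₂ * ((n₂ : ℝ) - 1) →
      e₂ ^ 2 ≤ e₃ ^ 2 - (n₂ : ℝ) * (b₃ * (2 * e₃ - b₃)) + ρ ^ 2 * n₂ * ((n₂ : ℝ) - 1) →
      ThreeHoleGoal m₁ k₁ m₂ k₂ m₃ k₃

end System

/-! ## §D2 Reading a marked fibre off at its holes: (F₃) ⟸ (Σ₃) -/

section Reduction

variable {R_N ρ : ℝ} {e m : ℤ → ℝ} {S : Finset ℤ} {t₀ : ℤ}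

/-- ★ The hole data of a marked position. -/
theorem kb_holeData (hρ : 0 < ρ) (hF : IsMarkedFibre R_N ρ e m S t₀) {t : ℤ} (ht : t ∈ S) :
    IsHoleData ρ (e t) (m t) (e t - e (t + 1)) (e t - e (t - 1)) (kink1 ρ e t) := by
  obtain ⟨-, hup, -, hm1, hm2, -, -, hsum⟩ := kb_hole hρ hF ht
  obtain ⟨-, hr0, hd0⟩ := kb_hole_depth hρ hF ht
  have hlip := hF.2.1
  have hl0 := (abs_le.1 (hlip t)).1
  have hl1 := hlip (t - 1)
  rw [show t - 1 + 1 = t by ring] at hl1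
  have hl1' := (abs_le.1 hl1).2
  obtain ⟨hr, hc, -⟩ := hF.2.2.2.2.2.1 t ht
  have hmw := (hF.2.2.2.1 t).1
  exact ⟨hd0, by linarith, hr0, by linarith, by linarith, hmw, by linarith, by linarith, hr, hc, hup⟩

/-- ★★ THE SYSTEM APPLIES TO EVERY SORTED TRIPLE of marked positions `t₁ < t₂ < t₃` of a marked fibre (`R_N = 80`): the gaps are even and inside the
window, the hole data are `kb_holeData`, the legs are `kb_leg'`, the parabolas `kb_parabola` / `kb_parabola_back`. -/
theorem kb_three_goal {ρlo ρhi : ℝ} (hS : ThreeHoleSystemQ ρlo ρhi) (hρ : 0 < ρ) (hρlo : ρlo ≤ ρ) (hρhi : ρ ≤ ρhi)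
    (hF : IsMarkedFibre 80 ρ e m S t₀) {t₁ t₂ t₃ : ℤ} (h₁ : t₁ ∈ S) (h₂ : t₂ ∈ S) (h₃ : t₃ ∈ S) (h12 : t₁ < t₂) (h23 : t₂ < t₃) :
    ThreeHoleGoal (m t₁) (kink1 ρ e t₁) (m t₂) (kink1 ρ e t₂) (m t₃) (kink1 ρ e t₃) := by
  have hsc := hF.2.2.1
  have hwin := hF.2.2.2.2.1
  obtain ⟨n₁, hn₁⟩ : ∃ n : ℕ, (n : ℤ) = t₂ - t₁ := ⟨(t₂ - t₁).toNat, Int.toNat_of_nonneg (by omega)⟩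
  obtain ⟨n₂, hn₂⟩ : ∃ n : ℕ, (n : ℤ) = t₃ - t₂ := ⟨(t₃ - t₂).toNat, Int.toNat_of_nonneg (by omega)⟩
  have hn₁R : (n₁ : ℝ) = (t₂ : ℝ) - t₁ := by exact_mod_cast hn₁
  have hn₂R : (n₂ : ℝ) = (t₃ : ℝ) - t₂ := by exact_mod_cast hn₂
  have hev₁ : Even n₁ := by
    have h := (hwin t₂ h₂ t₁ h₁).1
    rw [← hn₁] at h
    exact (Int.even_coe_nat n₁).1 h
  have hev₂ : Even n₂ := by
    have h := (hwin t₃ h₃ t₂ h₂).1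
    rw [← hn₂] at h
    exact (Int.even_coe_nat n₂).1 h
  have hw : ρ * ((n₁ : ℝ) + n₂) ≤ 160 + 2 * ρ := by
    have h := kb_window hF h₁ h₃ (h12.trans h23)
    rw [hn₁R, hn₂R]
    linarith
  have hl12 := kb_leg' hsc h12
  have hl23 := kb_leg' hsc h23
  have hp12 := kb_parabola hsc t₁ n₁
  rw [show t₁ + (n₁ : ℤ) = t₂ by omega] at hp12
  have hq12 := kb_parabola_back hsc t₂ n₁
  rw [show t₂ - (n₁ : ℤ) = t₁ by omega] at hq12
  have hp23 := kb_parabola hsc t₂ n₂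
  rw [show t₂ + (n₂ : ℤ) = t₃ by omega] at hp23
  have hq23 := kb_parabola_back hsc t₃ n₂
  rw [show t₃ - (n₂ : ℤ) = t₂ by omega] at hq23
  refine hS ρ hρlo hρhi n₁ n₂ (e t₁) (m t₁) (e t₁ - e (t₁ + 1)) (e t₁ - e (t₁ - 1)) (kink1 ρ e t₁)
    (e t₂) (m t₂) (e t₂ - e (t₂ + 1)) (e t₂ - e (t₂ - 1)) (kink1 ρ e t₂)
    (e t₃) (m t₃) (e t₃ - e (t₃ + 1)) (e t₃ - e (t₃ - 1)) (kink1 ρ e t₃)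
    hev₁ hev₂ (by omega) (by omega) hw (kb_holeData hρ hF h₁) (kb_holeData hρ hF h₂) (kb_holeData hρ hF h₃)
    ?_ ?_ ?_ ?_ ?_ ?_
  · rw [hn₁R]; linarith
  · rw [hn₂R]; linarith
  · linarith
  · linarith
  · linarith
  · linarith

/-- ★★★ **(F₃) ⟸ (Σ₃)** (PROVED; `R_N = 80`, any `0 < ρlo`): the three marked positions are the key `t₀` and two others `u < v`; according to the
position of the key among them, the matching clause of `ThreeHoleGoal` for the sorted triple is the claim. -/
theorem fibreChargeThreeMidQ_of_system {ρlo ρhi : ℝ} (hlo : 0 < ρlo) (hS : ThreeHoleSystemQ ρlo ρhi) :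
    FibreChargeThreeMidQ 80 ρlo ρhi := by
  intro ρ hρlo hρhi e m S t₀ hF hj3 hj6 hc3
  have hρ : 0 < ρ := lt_of_lt_of_le hlo hρlo
  have ht₀ : t₀ ∈ S := hF.2.2.2.2.2.2.1
  have hkle : ∀ t ∈ S, kink1 ρ e t ≤ kink1 ρ e t₀ := by
    intro t ht
    rcases hF.2.2.2.2.2.2.2 t ht with h | ⟨h, -⟩
    · exact h.le
    · exact h.le
  obtain ⟨u, v, hu, hv, hut, hvt, huv, hsum⟩ := kb_sum_three hc3 ht₀ (fun t => capK (m t) (kink1 ρ e t))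
  rw [hsum, hc3]
  suffices h : capK (m u) (kink1 ρ e u) + capK (m v) (kink1 ρ e v) ≤ lineExcess (capKCol (kink1 ρ e t₀)) 3 by
    linarith
  rcases lt_or_gt_of_ne hut with h1 | h1
  · rcases lt_or_gt_of_ne hvt with h2 | h2
    · obtain ⟨-, -, h⟩ := kb_three_goal hS hρ hρlo hρhi hF hu hv ht₀ huv h2
      exact h (hkle u hu) (hkle v hv) hj3 hj6
    · obtain ⟨-, h, -⟩ := kb_three_goal hS hρ hρlo hρhi hF hu ht₀ hv h1 h2
      exact h (hkle u hu) (hkle v hv) hj3 hj6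
  · obtain ⟨h, -, -⟩ := kb_three_goal hS hρ hρlo hρhi hF ht₀ hu hv h1 huv
    exact h (hkle u hu) (hkle v hv) hj3 hj6

end Reduction

end Summit.AtomisticToContinuum.Crystallization.Theorems.ChargedEnergyGapChartDial
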